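import Mathlib.Data.Fintype.Basic
import Mathlib.Data.Fintype.Pi
import Mathlib.Data.Fintype.Sum
import Mathlib.Data.Fintype.Prod
import Mathlib.SetTheory.Cardinal.Finite
import Mathlib.Logic.Function.Basic
import Literature.Computability.Complexity.CNF
import Literature.Computability.MetaComplexity.ResolutionWidthFamilies
import HarnessLib

/-!
# Affine block restrictions and single-row fibres of index-gadget lifts

Object layer for lower-bound arguments on index-gadget lifts `φ ∘ IND_m` (blocks `E`, pointer
bits `Sum.inl (e, α)`, cells `Sum.inr (e, α)`, `α : Fin m`; cf. `IndexGadgetLift.lean`) that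
combine a random restriction of the BASE formula with a walk along a SINGLE ROW `x : E → Fin m`
of the lifted cube.

* `AffRestr E N'` — an AFFINE (block) restriction of the old variables `E` onto `N'` new
  variables: every old variable is fixed to a constant or identified, up to a sign, with one new
  variable (Håstad–Risse, §3: "a full restriction is really an affine restriction … identifies
  old variables with new variables or the negations thereof"); `restrict` applies it to a CNF.
* Row fibres: at a row `x` the POINTED cell of block `e` is `(e, x e)`; cell contents
  `y : E × Fin m → Bool` induce the PATTERN `pattern ρ x y : Fin N' → Bool` (the values of the
  new variables read off the pointed cells of designated witness blocks); the LIVE CUBE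
  `liveCube ρ x` consists of the `y` whose pointed cells realise `ρ` at that pattern; the
  FIBRE of an event (e.g. "line `u` is false") is its trace on the live cube.
* LIGHT/FULL decision trees over pattern space (`PTree`, `IsLight`, `IsFull`, `IsLFTree`,
  `Shallow`) and the cumulative EXCISION process along a sequence of fibres (`excision`,
  `ResShallow`): the single-row, fibred form of the structured-vs-error rectangle partition with
  cumulative error removal of dag-like lifting (Garg–Göös–Kamath–Sokolov 2018, §5), with
  Håstad-style canonical decision trees in place of rectangle partitions.  A leaf is LIGHT when
  its sub-fibre has density `≤ 2^{-L}` in the live cube and FULL when every total pattern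
  extending it is realised.
* Restriction SPACES `Fin T → AffRestr E N'` (uniform), counting-form probability `ProbLE`,
  the per-line TAIL property `TailShallow` and the sequence property `Tame`, and width
  certificates `IsExtendibleFamily` (the Duplicator families of `ResolutionWidthFamilies`).

Definitions only (plus unfolding lemmas); introduced for the route
`Summits/PneNP/PneNP/Theses/RcpLiftedTseitinRowWalk`.  Everything is finite counting: no
measure theory.

## References
* J. Håstad, K. Risse, *On bounded depth proofs for Tseitin formulas on the grid; revisited*,
  FOCS 2022 / SICOMP 2025, §3 (full = affine restrictions) and §4 (canonical decision trees,
  switching) [HastadRisse2025].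
* A. Garg, M. Göös, P. Kamath, D. Sokolov, *Monotone circuit lower bounds from resolution*,
  STOC 2018, §5 (dag-like lifting: reverse topological processing, structured parts, cumulative
  error sets) [GargEtAl2018].
* A. Atserias, V. Dalmau, JCSS 74 (2008), §3 (extendible families ⇒ width) [AtseriasDalmau2008].
-/

namespace Literature.Computability.MetaComplexity

open Literature.Computability.Complexity

/-! ### Affine block restrictions -/

/-- An AFFINE (block) restriction of old variables `E` onto `N'` new variables: `val e` fixes
`e` to a constant (`Sum.inl c`) or identifies it with a signed new variable (`Sum.inr (ν, s)`,
meaning `e ≡ ν ⊕ s`); every new variable `ν` has a designated witness block `wit ν` tied to it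
with sign `sgn ν`. [cite: HastadRisse2025, §3] -/
structure AffRestr (E : Type*) (N' : ℕ) where
  /-- constant, or (new variable, sign) -/
  val : E → Bool ⊕ (Fin N' × Bool)
  /-- a block tied to each new variable -/
  wit : Fin N' → E
  /-- the sign of that tie -/
  sgn : Fin N' → Bool
  /-- the witness block of `ν` is tied to `ν` with sign `sgn ν` -/
  val_wit : ∀ ν, val (wit ν) = Sum.inr (ν, sgn ν)

namespace AffRestr

variable {E : Type*} {N' : ℕ} (ρ : AffRestr E N')

/-- The value of the old variable `e` under `ρ` at the new assignment `z`.
[cite: HastadRisse2025, §3] -/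
def blockVal (z : Fin N' → Bool) (e : E) : Bool :=
  match ρ.val e with
  | Sum.inl c => c
  | Sum.inr p => xor (z p.1) p.2

/-- Restricting one clause: `none` if some literal became true (the clause disappears), else
the clause of surviving new literals (`(e, b)` with `e ≡ ν ⊕ s` becomes `(ν, b ⊕ s)`; false
constant literals are dropped). [cite: HastadRisse2025, §3] -/
def restrictClause : Clause E → Option (Clause (Fin N'))
  | [] => some []
  | (e, b) :: C =>
    match ρ.val e with
    | Sum.inl c => if c = b then none else restrictClause C
    | Sum.inr p => (restrictClause C).map (List.cons (p.1, xor b p.2))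

/-- The restricted CNF `φ|ρ` over the new variables. [cite: HastadRisse2025, §3] -/
def restrict (φ : CNF E) : CNF (Fin N') :=
  φ.filterMap ρ.restrictClause

/-- Semantics of `restrictClause`: a vanished clause is true, a surviving clause evaluates at
`z` as the original clause at `blockVal z`. [cite: HastadRisse2025, §3] -/
theorem restrictClause_spec (z : Fin N' → Bool) :
    ∀ C : Clause E, match ρ.restrictClause C with
      | none => C.eval (ρ.blockVal z) = true
      | some C' => C'.eval z = C.eval (ρ.blockVal z)
  | [] => by simp [restrictClause, Clause.eval]
  | (e, b) :: C => by
      have ih := restrictClause_spec z C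
      have hcons : ∀ (τ : E → Bool), Clause.eval τ ((e, b) :: C) =
          ((τ e == b) || Clause.eval τ C) := fun τ => rfl
      simp only [restrictClause]
      cases hv : ρ.val e with
      | inl c =>
          have hbv : ρ.blockVal z e = c := by simp [blockVal, hv]
          by_cases hcb : c = b
          · simp [hcb, hcons, hbv]
          · simp only [hcb, if_false]
            revert ih
            cases ρ.restrictClause C with
            | none => intro ih; simp [hcons, ih]
            | some C' => intro ih; simp [hcons, ih, hbv, hcb]
      | inr p =>
          have hbv : ρ.blockVal z e = xor (z p.1) p.2 := by simp [blockVal, hv]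
          revert ih
          cases ρ.restrictClause C with
          | none => intro ih; simp [hcons, ih]
          | some C' =>
              intro ih
              have hc' : Clause.eval z ((p.1, xor b p.2) :: C') =
                  ((z p.1 == xor b p.2) || Clause.eval z C') := rfl
              simp only [Option.map_some, hc', hcons, ih, hbv]
              cases z p.1 <;> cases b <;> cases p.2 <;> rfl

/-- Semantics of `restrict`: `(φ|ρ)(z) = φ(blockVal z)`. [cite: HastadRisse2025, §3] -/
theorem eval_restrict (φ : CNF E) (z : Fin N' → Bool) :
    (ρ.restrict φ).eval z = φ.eval (ρ.blockVal z) := by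
  induction φ with
  | nil => rfl
  | cons C φ ih =>
      have spec := ρ.restrictClause_spec z C
      simp only [restrict, List.filterMap_cons] at *
      revert spec
      cases ρ.restrictClause C with
      | none => intro spec; simp [CNF.eval_cons, spec, ← ih]
      | some C' => intro spec; simp [CNF.eval_cons, spec, ← ih]

end AffRestr

/-! ### Rows, patterns, live cube, fibres -/

/-- The total assignment of the lifted variables (pointer bits `Sum.inl (e, α)`, cells
`Sum.inr (e, α)`) at ROW `x` with cell contents `y`: pointer bit `(e, α)` is on iff `x e = α`.
[cite: GargEtAl2018, §2] -/
def rowAssignment {E : Type*} {m : ℕ} (x : E → Fin m) (y : E × Fin m → Bool) :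
    (E × Fin m) ⊕ (E × Fin m) → Bool :=
  Sum.elim (fun p => decide (x p.1 = p.2)) y

namespace AffRestr

variable {E : Type*} {N' : ℕ} (ρ : AffRestr E N') {m : ℕ}

/-- The PATTERN of cell contents `y` at row `x`: the new-variable assignment read off the
pointed cells of the witness blocks, `z ν := y_{(wit ν, x (wit ν))} ⊕ sgn ν`.
[cite: GargEtAl2018, §5] -/
def pattern (x : E → Fin m) (y : E × Fin m → Bool) : Fin N' → Bool :=
  fun ν => xor (y (ρ.wit ν, x (ρ.wit ν))) (ρ.sgn ν)

/-- The LIVE CUBE `Y₀(ρ, x)`: cell contents whose pointed cells realise `ρ` (fixed blocks show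
their constant, tied blocks agree, with signs, with the pattern). [cite: GargEtAl2018, §5] -/
def liveCube (x : E → Fin m) : Set (E × Fin m → Bool) :=
  {y | ∀ e, y (e, x e) = ρ.blockVal (ρ.pattern x y) e}

/-- The FIBRE at row `x` of an event on lifted assignments (typically "line `u` is false"):
its trace on the live cube. [cite: GargEtAl2018, §5] -/
def fibre (x : E → Fin m) (bad : ((E × Fin m) ⊕ (E × Fin m) → Bool) → Prop) :
    Set (E × Fin m → Bool) :=
  {y | y ∈ ρ.liveCube x ∧ bad (rowAssignment x y)}

/-- The sub-fibre of `A` at a partial pattern `lam`: points of `A` whose pattern extends `lam`.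
[cite: GargEtAl2018, §5] -/
def subfibre (x : E → Fin m) (A : Set (E × Fin m → Bool)) (lam : Fin N' → Option Bool) :
    Set (E × Fin m → Bool) :=
  {y | y ∈ A ∧ ∀ ν b, lam ν = some b → ρ.pattern x y ν = b}

/-- LIGHT at exponent `L`: the sub-fibre has density at most `2^{-L}` in the live cube.
[cite: GargEtAl2018, §5] -/
def IsLight (x : E → Fin m) (L : ℕ) (A : Set (E × Fin m → Bool)) (lam : Fin N' → Option Bool) :
    Prop :=
  Nat.card (ρ.subfibre x A lam) * 2 ^ L ≤ Nat.card (ρ.liveCube x)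

/-- FULL: every total pattern extending `lam` is realised by a point of `A`.
[cite: GargEtAl2018, §5] -/
def IsFull (x : E → Fin m) (A : Set (E × Fin m → Bool)) (lam : Fin N' → Option Bool) : Prop :=
  ∀ z : Fin N' → Bool, (∀ ν b, lam ν = some b → z ν = b) → ∃ y ∈ A, ρ.pattern x y = z

end AffRestr

/-! ### Decision trees over pattern space -/

/-- Binary decision trees querying new variables (pattern coordinates). [folklore] -/
inductive PTree (N' : ℕ) : Type
  | leaf : PTree N'
  | node : Fin N' → PTree N' → PTree N' → PTree N'

namespace PTree

variable {N' : ℕ}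

/-- Depth of a decision tree. [folklore] -/
def depth : PTree N' → ℕ
  | leaf => 0
  | node _ l r => max l.depth r.depth + 1

/-- The leaves of a tree, as the partial patterns recorded along the branches from `lam`
(left child = queried variable set to `false`). [folklore] -/
def leaves : PTree N' → (Fin N' → Option Bool) → List (Fin N' → Option Bool)
  | leaf, lam => [lam]
  | node ν l r, lam =>
      l.leaves (Function.update lam ν (some false)) ++ r.leaves (Function.update lam ν (some true))

/-- The one-leaf tree has depth `0`. [folklore] -/
@[simp] theorem depth_leaf : (leaf : PTree N').depth = 0 := rfl

/-- The one-leaf tree has the root as its only leaf. [folklore] -/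
@[simp] theorem leaves_leaf (lam : Fin N' → Option Bool) : (leaf : PTree N').leaves lam = [lam] :=
  rfl

end PTree

namespace AffRestr

variable {E : Type*} {N' : ℕ} (ρ : AffRestr E N') {m : ℕ}

/-- `t` is a LIGHT/FULL tree for the fibre `A` at row `x` and exponent `L`: every leaf is light
or full. [cite: GargEtAl2018, §5] -/
def IsLFTree (x : E → Fin m) (L : ℕ) (A : Set (E × Fin m → Bool)) (t : PTree N') : Prop :=
  ∀ lam ∈ t.leaves (fun _ => none), ρ.IsLight x L A lam ∨ ρ.IsFull x A lam

/-- `A` is `w`-SHALLOW (at row `x`, exponent `L`): it admits a LIGHT/FULL tree of depth `≤ w`.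
The minimum such `w` is the (intrinsic) LIGHT/FULL depth of `A`. [cite: GargEtAl2018, §5] -/
def Shallow (x : E → Fin m) (L w : ℕ) (A : Set (E × Fin m → Bool)) : Prop :=
  ∃ t : PTree N', t.depth ≤ w ∧ ρ.IsLFTree x L A t

/-- The LIGHT PART of `A` cut out by the tree `t`: the union of the sub-fibres at light leaves
(the "error set" to be excised). [cite: GargEtAl2018, §5] -/
def lightPart (x : E → Fin m) (L : ℕ) (A : Set (E × Fin m → Bool)) (t : PTree N') :
    Set (E × Fin m → Bool) :=
  {y | ∃ lam ∈ t.leaves (fun _ => none), ρ.IsLight x L A lam ∧ y ∈ ρ.subfibre x A lam}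

/-- The cumulative EXCISION process along a sequence of fibres `A₁, …, A_s` (derivation order)
with trees `t₁, …, t_s` and excised set `D`: `tᵢ` must be a LIGHT/FULL tree of depth `≤ w` for
the RESIDUAL `Aᵢ \ D`, after which the light part of that residual is added to `D`.
`False` on length mismatch. [cite: GargEtAl2018, §5] -/
def excision (x : E → Fin m) (L w : ℕ) :
    List (Set (E × Fin m → Bool)) → List (PTree N') → Set (E × Fin m → Bool) → Prop
  | [], [], _ => True
  | A :: As, t :: ts, D =>
      (t.depth ≤ w ∧ ρ.IsLFTree x L (A \ D) t) ∧ excision x L w As ts (D ∪ ρ.lightPart x L (A \ D) t)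
  | [], _ :: _, _ => False
  | _ :: _, [], _ => False

/-- The sequence of fibres is RESIDUALLY `w`-SHALLOW: some choice of trees runs the excision
process from `D = ∅` with all depths `≤ w`. [cite: GargEtAl2018, §5] -/
def ResShallow (x : E → Fin m) (L w : ℕ) (As : List (Set (E × Fin m → Bool))) : Prop :=
  ∃ ts : List (PTree N'), ρ.excision x L w As ts ∅

/-- Unfolding `excision` on a cons. [cite: GargEtAl2018, §5] -/
theorem excision_cons (x : E → Fin m) (L w : ℕ) (A : Set (E × Fin m → Bool))
    (As : List (Set (E × Fin m → Bool))) (t : PTree N') (ts : List (PTree N'))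
    (D : Set (E × Fin m → Bool)) :
    ρ.excision x L w (A :: As) (t :: ts) D ↔
      (t.depth ≤ w ∧ ρ.IsLFTree x L (A \ D) t) ∧
        ρ.excision x L w As ts (D ∪ ρ.lightPart x L (A \ D) t) :=
  Iff.rfl

/-- The empty sequence is residually shallow. [cite: GargEtAl2018, §5] -/
theorem resShallow_nil (x : E → Fin m) (L w : ℕ) : ρ.ResShallow x L w ([] : List _) :=
  ⟨[], trivial⟩

end AffRestr

/-! ### Restriction spaces, probabilities in counting form, tail and tameness -/

/-- `Pr_{(ω,x)}[ev] ≤ num/den` for the uniform distribution on `Fin T × (E → Fin m)` (sample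
index and row), in cross-multiplied counting form. [folklore] -/
def ProbLE {E : Type*} (T m : ℕ) (ev : Fin T → (E → Fin m) → Prop) (num den : ℕ) : Prop :=
  Nat.card {p : Fin T × (E → Fin m) // ev p.1 p.2} * den ≤ num * Nat.card (Fin T × (E → Fin m))

/-- TAIL property of a restriction space `S : Fin T → AffRestr E N'` for a class of lines `Λ`
(with a size `size` and a falsity event `bad`) at arity `m`, scale `k`, budget `w`, exponent
`L`: every line of size `≤ 2^k` has a `w`-shallow fibre except with probability `≤ 2^{-2k}` over
`(ω, x)`. [cite: GargEtAl2018, §5] -/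
def TailShallow {E : Type*} {N' T : ℕ} (S : Fin T → AffRestr E N') (m k w L : ℕ) {Λ : Type*}
    (size : Λ → ℕ) (bad : Λ → ((E × Fin m) ⊕ (E × Fin m) → Bool) → Prop) : Prop :=
  ∀ u : Λ, size u ≤ 2 ^ k →
    ProbLE T m (fun ω x => ¬ (S ω).Shallow x L w ((S ω).fibre x (bad u))) 1 (2 ^ (2 * k))

/-- TAMENESS of excision for a restriction space at `(m, k, w, L)`: for every sequence of at most
`2^{k-8}` lines of size `≤ 2^k`, the probability over `(ω, x)` that every fibre is intrinsically
`w`-shallow and yet the sequence is not residually `3w`-shallow is at most `1/4`.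
[cite: GargEtAl2018, §5] -/
def Tame {E : Type*} {N' T : ℕ} (S : Fin T → AffRestr E N') (m k w L : ℕ) {Λ : Type*}
    (size : Λ → ℕ) (bad : Λ → ((E × Fin m) ⊕ (E × Fin m) → Bool) → Prop) : Prop :=
  ∀ us : List Λ, us.length ≤ 2 ^ (k - 8) → (∀ u ∈ us, size u ≤ 2 ^ k) →
    ProbLE T m (fun ω x =>
      (∀ u ∈ us, (S ω).Shallow x L w ((S ω).fibre x (bad u))) ∧
        ¬ (S ω).ResShallow x L (3 * w) (us.map fun u => (S ω).fibre x (bad u))) 1 4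

/-! ### Width certificates -/

/-- A Duplicator (extendible) family for the CNF `ψ` at width `W`: a nonempty, down-closed set
of partial assignments falsifying no clause of `ψ`, every member of size `≤ W` extendible to
either value of any variable — exactly the hypotheses of `lt_resWidth_of_family`
(Atserias–Dalmau 2008, §3). [cite: AtseriasDalmau2008, §3] -/
def IsExtendibleFamily {ν : Type*} [DecidableEq ν] (ψ : CNF ν) (W : ℕ)
    (H : Set (Finset (Literal ν))) : Prop :=
  H.Nonempty ∧ (∀ α ∈ H, ∀ β ⊆ α, β ∈ H) ∧ (∀ α ∈ H, ∀ c ∈ ψ, ¬ Falsifies α c.toFinset) ∧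
    (∀ α ∈ H, α.card ≤ W → ∀ v : ν, ∃ b : Bool, insert (v, b) α ∈ H)

/-- An extendible family of width `W` forces every resolution refutation to have width `> W`
(`lt_resWidth_of_family`). [cite: AtseriasDalmau2008, §3] -/
theorem IsExtendibleFamily.lt_resWidth {ν : Type*} [DecidableEq ν] {ψ : CNF ν} {W : ℕ}
    {H : Set (Finset (Literal ν))} (h : IsExtendibleFamily ψ W H) {π : List (ResLine ν)}
    (hπ : IsResRefutation ψ π) : W < resWidth π :=
  lt_resWidth_of_family h.1 h.2.1 h.2.2.1 h.2.2.2 hπ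

/-- Extendibility is monotone in the width. [cite: AtseriasDalmau2008, §3] -/
theorem IsExtendibleFamily.mono {ν : Type*} [DecidableEq ν] {ψ : CNF ν} {W W' : ℕ}
    {H : Set (Finset (Literal ν))} (h : IsExtendibleFamily ψ W H) (hW : W' ≤ W) :
    IsExtendibleFamily ψ W' H :=
  ⟨h.1, h.2.1, h.2.2.1, fun α hα hc v => h.2.2.2 α hα (hc.trans hW) v⟩

end Literature.Computability.MetaComplexity
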